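import Literature.AlgebraicGeometry.Frobenioids.BirationalizationFunctor
import Literature.AlgebraicGeometry.Frobenioids.IsometricPreStepsPullback
import HarnessLib

/-!
# Frobenioids I, Proposition 4.4 (iv): pull-back morphisms of `C` are pull-back morphisms of
`C^birat`

Mochizuki, *The geometry of Frobenioids I: the general theory*, Kyushu J. Math. **62** (2008)
293–400, §4, Proposition 4.4 (iv), kurims text p. 83 ll. 32–37
[cite: MochizukiFrdI2008, Prop. 4.4(iv) p.83], verbatim:
"A morphism of `C` maps to a(n) co-angular morphism (respectively, isomorphism; morphism of
Frobenius type; pull-back morphism; morphism of a given Frobenius degree; isometry; pre-step;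
base-isomorphism) of `C^birat` if and only if it is a(n) co-angular morphism (respectively,
co-angular pre-step; co-angular base-isomorphism; co-angular linear morphism; morphism of a given
Frobenius degree; arbitrary morphism; pre-step; base-isomorphism) of `C`."

Scope of this file (our words, not print's): of the printed pairings we treat here the pairing
«morphism of a given Frobenius degree ↔ morphism of a given Frobenius degree» (as the equality of
Frobenius degrees `degFr_toBirat_map`), the pairing «pre-step ↔ pre-step» ("if" direction,
`isPreStep_toBirat_map`) and the pairing «base-isomorphism ↔ base-isomorphism» (as an iff,
`isBaseIso_toBirat_map_iff`), together with linearity (an iff by definition of the structure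
functor, `isLinear_toBirat_map_iff`), and — the main content — the pairing «pull-back morphism of
`C^birat` ↔ co-angular linear morphism of `C`» in the following UNDER-CLAIMING "if"-type form: the
image in `C^birat` of a PULL-BACK MORPHISM of `C` is a pull-back morphism of `C^birat`
(`isPullbackMorphism_toBirat_map`).  The form with print's hypothesis (co-angular linear morphism of
`C`) is `Birat.isPullbackMorphism_toBirat_map_of_isCoAngular` in `BirationalizationIsos.lean`, which
also carries the "if" directions of the pairings «isomorphism ↔ co-angular pre-step» and (for
Frobenioids of isotropic type) «pull-back ↔ linear»; the "only if" directions are seat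
abc-iut-w5-d004's `BirationalizationProp44Converse.lean`.  Nothing else of (iv) is claimed here.

For the structure functor `C^birat → F_{Φ^gp}` (`Birat.toElemGp`, part 3) and a pull-back morphism
`φ : A → B` of `C`, the image `φ^birat` has the universal property of Def. 1.2 (ii) in `C^birat`:
given a birational morphism `g = [(β, χ)] : X ⇢ B` and a base map `b : Base X → Base A` with
`Base g = b ≫ Base φ`, the unique lift is `[(β, γ₀)]` where `γ₀` lifts `χ` through `φ` over
`Base(β) ≫ b` (existence: `IsPullbackMorphism.exists_lift`; uniqueness: `IsPullbackMorphism.hom_ext`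
after a common refinement — both seat abc-iut-L1-t1's `IsometricPreStepsPullback.lean`).
-/

namespace Literature.AlgebraicGeometry.Frobenioids

open CategoryTheory Opposite

universe w v v' u u'

namespace PreFrobenioid

namespace Birat

variable {D : Type u} [Category.{v} D] {Φ : Dᵒᵖ ⥤ CommMonCat.{w}}
  {C : Type u'} [Category.{v'} C] {F : C ⥤ ElemFrobenioid Φ} {hF : IsFrobenioid F}
  {hsq : HasBiratSquares F}

/-- The base map of a birational morphism under `C^birat → F_{Φ^gp} → D` is `BiratFrac.base`.
[cite: MochizukiFrdI2008, Prop. 4.4(i) p.83] -/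
theorem base_toElemGp_homMk {X Y : Birat F hF hsq} (f : BiratFrac F X.out Y.out) :
    Base (toElemGp hF hsq) (homMk f) = BiratFrac.base f := rfl

/-- Frobenius degrees are preserved by `C → C^birat → F_{Φ^gp}`; this is print's pairing of the
morphisms of a given Frobenius degree of `C^birat` with the morphisms of the same Frobenius degree of
`C` (p. 83 ll. 32–37), stated as an equality of degrees. [cite: MochizukiFrdI2008, Prop. 4.4(iv) p.83] -/
theorem degFr_toBirat_map {A B : C} (φ : A ⟶ B) :
    degFr (toElemGp hF hsq) ((toBirat F hF hsq).map φ) = degFr F φ := rfl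

/-- Base maps are preserved by `C → C^birat → F_{Φ^gp} → D`.
[cite: MochizukiFrdI2008, Prop. 4.4(iv) p.83] -/
theorem base_toBirat_map {A B : C} (φ : A ⟶ B) :
    Base (toElemGp hF hsq) ((toBirat F hF hsq).map φ) = Base F φ :=
  BiratFrac.base_ofHom hF φ

/-- **Prop. 4.4 (iv)**, linear morphisms: `φ^birat` is linear iff `φ` is.
[cite: MochizukiFrdI2008, Prop. 4.4(iv) p.83] -/
theorem isLinear_toBirat_map_iff {A B : C} (φ : A ⟶ B) :
    IsLinear (toElemGp hF hsq) ((toBirat F hF hsq).map φ) ↔ IsLinear F φ := Iff.rfl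

/-- **Prop. 4.4 (iv)**, base-isomorphisms: `φ^birat` is a base-isomorphism iff `φ` is.
[cite: MochizukiFrdI2008, Prop. 4.4(iv) p.83] -/
theorem isBaseIso_toBirat_map_iff {A B : C} (φ : A ⟶ B) :
    IsBaseIso (toElemGp hF hsq) ((toBirat F hF hsq).map φ) ↔ IsBaseIso F φ := by
  unfold IsBaseIso
  rw [base_toBirat_map]
  rfl

/-- **Prop. 4.4 (iv)**, pre-steps: the image of a pre-step of `C` is a pre-step of `C^birat`.
[cite: MochizukiFrdI2008, Prop. 4.4(iv) p.83] -/
theorem isPreStep_toBirat_map {A B : C} {φ : A ⟶ B} (hφ : IsPreStep F φ) :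
    IsPreStep (toElemGp hF hsq) ((toBirat F hF hsq).map φ) :=
  ⟨(isLinear_toBirat_map_iff φ).mpr hφ.1, (isBaseIso_toBirat_map_iff φ).mpr hφ.2⟩

/-- **Prop. 4.4 (iv)**: the image in `C^birat` of a pull-back morphism of `C` is a pull-back
morphism
of `C^birat` (for the pre-Frobenioid structure `C^birat → F_{Φ^gp}`).
[cite: MochizukiFrdI2008, Prop. 4.4(iv) p.83] -/
theorem isPullbackMorphism_toBirat_map {A B : C} {φ : A ⟶ B} (hφ : IsPullbackMorphism F φ) :
    IsPullbackMorphism (toElemGp hF hsq) ((toBirat F hF hsq).map φ) := by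
  intro X
  constructor
  · -- uniqueness
    intro γ γ' h
    obtain ⟨f, rfl⟩ := homMk_surjective γ
    obtain ⟨f', rfl⟩ := homMk_surjective γ'
    have h1 := congrArg (fun p : PullbackHomData (toElemGp hF hsq) ((toBirat F hF hsq).map φ) X =>
      p.1.1) h
    have h2 := congrArg (fun p : PullbackHomData (toElemGp hF hsq) ((toBirat F hF hsq).map φ) X =>
      p.1.2) h
    change homMk f ≫ (toBirat F hF hsq).map φ = homMk f' ≫ (toBirat F hF hsq).map φ at h1
    change BiratFrac.base f = BiratFrac.base f' at h2
    haveI : IsIso (Base F f.den) := f.den_mem.2.2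
    haveI : IsIso (Base F f'.den) := f'.den_mem.2.2
    -- `[(β, χ)] ≫ φ^birat = [(β, χ ≫ φ)]`
    have hc : ∀ k : BiratFrac F X.out ((toBirat F hF hsq).obj A).out,
        homMk k ≫ (toBirat F hF hsq).map φ =
        homMk (Y := (toBirat F hF hsq).obj B) ⟨k.src, k.den, k.num ≫ φ, k.den_mem⟩ := fun k => by
      let S : BiratFrac.Square k (BiratFrac.ofHom hF φ) :=
        { apex := k.src, left := 𝟙 _, right := k.num, left_mem := isCoAngularPreStep_id hF _
          w := (Category.id_comp _).trans (Category.comp_id _).symm }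
      refine (homMk_comp_homMk_eq (Z := (toBirat F hF hsq).obj B) k (BiratFrac.ofHom hF φ)
        S).trans ?_
      apply homMk_sound
      refine ⟨k.src, 𝟙 _, 𝟙 _, isCoAngularPreStep_id hF _, isCoAngularPreStep_id hF _, ?_, rfl⟩
      change 𝟙 _ ≫ 𝟙 _ ≫ k.den = 𝟙 _ ≫ k.den
      rw [Category.id_comp]
    rw [hc, hc, homMk_eq_homMk_iff] at h1
    obtain ⟨E, ε, ε', hε, hε', hden, hnum⟩ := h1
    change ε ≫ f.den = ε' ≫ f'.den at hden
    change ε ≫ f.num ≫ φ = ε' ≫ f'.num ≫ φ at hnum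
    apply homMk_sound
    refine ⟨E, ε, ε', hε, hε', hden, hφ.hom_ext ?_ ?_⟩
    · exact (Category.assoc _ _ _).trans (hnum.trans (Category.assoc _ _ _).symm)
    · -- bases: `Base ε ≫ Base f.num = Base ε' ≫ Base f'.num`
      have h2' : inv (Base F f.den) ≫ Base F f.num = inv (Base F f'.den) ≫ Base F f'.num := h2
      have hb : Base F f.num = Base F f.den ≫ inv (Base F f'.den) ≫ Base F f'.num :=
        (IsIso.inv_comp_eq _).mp h2'
      have hd : Base F ε ≫ Base F f.den = Base F ε' ≫ Base F f'.den := by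
        rw [← base_comp, hden, base_comp]
      calc Base F (ε ≫ f.num) = Base F ε ≫ Base F f.num := base_comp F ε f.num
        _ = Base F ε ≫ Base F f.den ≫ inv (Base F f'.den) ≫ Base F f'.num := by rw [hb]
        _ = (Base F ε' ≫ Base F f'.den) ≫ inv (Base F f'.den) ≫ Base F f'.num := by
            rw [← hd, Category.assoc]
        _ = Base F ε' ≫ Base F f'.num := by rw [Category.assoc, IsIso.hom_inv_id_assoc]
        _ = Base F (ε' ≫ f'.num) := (base_comp F ε' f'.num).symm
  · -- existence
    rintro ⟨⟨g, b⟩, hgb⟩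
    obtain ⟨f, rfl⟩ := homMk_surjective g
    haveI : IsIso (Base F f.den) := f.den_mem.2.2
    change BiratFrac.base f = b ≫ Base (toElemGp hF hsq) ((toBirat F hF hsq).map φ) at hgb
    have e : Base (toElemGp hF hsq) ((toBirat F hF hsq).map φ) = Base F φ :=
      BiratFrac.base_ofHom hF φ
    rw [e] at hgb
    -- lift `χ` through `φ` over `Base β ≫ b`
    have hgb' : inv (Base F f.den) ≫ Base F f.num = b ≫ Base F φ := hgb
    have hb : Base F f.num = (Base F f.den ≫ b) ≫ Base F φ :=
      ((IsIso.inv_comp_eq _).mp hgb').trans (Category.assoc _ _ _).symm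
    obtain ⟨γ₀, hγ₀φ, hγ₀b⟩ := hφ.exists_lift f.num (Base F f.den ≫ b) hb
    refine ⟨homMk (Y := (toBirat F hF hsq).obj A) ⟨f.src, f.den, γ₀, f.den_mem⟩, ?_⟩
    apply Subtype.ext
    apply Prod.ext
    · -- `[(β, γ₀)] ≫ φ^birat = [(β, γ₀ ≫ φ)] = [(β, χ)]`
      change homMk _ ≫ (toBirat F hF hsq).map φ = homMk f
      let S : BiratFrac.Square (⟨f.src, f.den, γ₀, f.den_mem⟩ : BiratFrac F X.out A)
          (BiratFrac.ofHom hF φ) :=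
        { apex := f.src, left := 𝟙 _, right := γ₀, left_mem := isCoAngularPreStep_id hF _
          w := (Category.id_comp _).trans (Category.comp_id _).symm }
      refine (homMk_comp_homMk_eq (Z := (toBirat F hF hsq).obj B) _ (BiratFrac.ofHom hF φ)
        S).trans ?_
      apply homMk_sound
      refine ⟨f.src, 𝟙 _, 𝟙 _, isCoAngularPreStep_id hF _, isCoAngularPreStep_id hF _, ?_, ?_⟩
      · change 𝟙 _ ≫ 𝟙 _ ≫ f.den = 𝟙 _ ≫ f.den
        rw [Category.id_comp]
      · change 𝟙 _ ≫ γ₀ ≫ φ = 𝟙 _ ≫ f.num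
        rw [hγ₀φ]
        rfl
    · -- base: `Base(β)⁻¹ ≫ Base γ₀ = b`
      change BiratFrac.base ⟨f.src, f.den, γ₀, f.den_mem⟩ = b
      change inv (Base F f.den) ≫ Base F γ₀ = b
      rw [hγ₀b, IsIso.inv_hom_id_assoc]

end Birat

end PreFrobenioid

end Literature.AlgebraicGeometry.Frobenioids
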